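import Literature.AlgebraicGeometry.Morphisms.FormalModuleTricky
import Literature.AlgebraicGeometry.Modules.IsoOfSectionsOnBasis

/-!
# Grothendieck's existence theorem: algebraization from an `a`-power isogeny to a completion tower

The Stacks Project, Tag 088A (Cohomology of Schemes, Lemma 30.27.3, the "tricky lemma" of
Grothendieck's existence theorem; Görtz–Wedhorn, *Algebraic Geometry II* (2023), §(24.21),
Lemma 24.105 / 24.106): a coherent formal module `𝓕` on a scheme `X` proper over an `a`-adically
complete noetherian ring `A` which maps to the completion `H^ = (H/aⁿ⁺¹H)_n` of a coherent module
`H` with levelwise kernels and cokernels killed by a FIXED power `𝒥ᵈ` of an ideal sheaf `𝒥` is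
algebraizable, provided all coherent formal modules killed by the powers `𝒥ᵉ` are (the tree's
`Morphisms/FormalModuleTricky.exists_coh_iso_of_torsion_kernel_cokernel`).

This file records the case **`𝒥 = (a)`**, where the inductive hypothesis is free: a formal tower
along `a` all of whose levels are killed by `aᵉ` is EVENTUALLY CONSTANT (its transition maps
`𝓖_{m+1} → 𝓖_m` are isomorphisms for `m + 1 ≥ e`, their kernels `aᵐ⁺¹𝓖_{m+1}` being zero) and is
therefore the completion tower of its `e`-th level (`exists_coh_iso_cmplTower_of_pow_killed`). Hence:

* `exists_coh_iso_cmplTower_of_powTorsion_comparison` — **a coherent formal tower `𝓕` along `a`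
  on `X` proper over the `a`-adically complete noetherian `A`, admitting a morphism of towers
  `α : 𝓕 → H^` to the completion of a coherent `H` whose levelwise kernels and cokernels are killed
  by `aᵈ` for one `d`, is isomorphic to the completion tower of a coherent `𝒪_X`-module.**

This is the form in which the tricky lemma is used when the comparison map is an `a`-power
ISOGENY (e.g. along a birational Chow cover of a normal scheme, where the relative theorem on
formal functions in degree `0` bounds kernel and cokernel by a power of `a` uniformly in `n`).
Everything is proved; no named facts; no definitions.

## References

* The Stacks Project, Tag 088A (Cohomology of Schemes, Lemma 30.27.3), Tag 087W. [StacksProject]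
* U. Görtz, T. Wedhorn, *Algebraic Geometry II: Cohomology of Schemes*, Springer Spektrum (2023),
  doi:10.1007/978-3-658-43031-3: (24.18.1) (p. 562), Lemma 24.105, Lemma 24.106 (pp. 572–573).
  [GortzWedhorn2023]
-/

noncomputable section

-- `TopCat.Presheaf`/`Scheme.Modules` are not reducible (as in Mathlib's `AlgebraicGeometry/Modules`).
set_option backward.isDefEq.respectTransparency false

open CategoryTheory AlgebraicGeometry Limits TopologicalSpace Opposite
open Literature.AlgebraicGeometry.Modules

universe u

namespace Literature.AlgebraicGeometry.Morphisms

/-! ### Modules killed by a power of a global function, and the ideal sheaf `(a)` -/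

section Killed

variable {X : Scheme.{u}} (a : Γ(X, ⊤))

/-- The ideal of the affine open `V` attached to `(a)ᵈ` is generated by `aᵈ|_V`. [folklore] -/
private theorem ideal_pow_ofIdealTop_span (d : ℕ) (V : X.affineOpens) :
    (Scheme.IdealSheafData.ofIdealTop (Ideal.span {a}) ^ d).ideal V =
      Ideal.span {X.presheaf.map (homOfLE (le_top : (V : X.Opens) ≤ ⊤)).op (a ^ d)} := by
  rw [Scheme.IdealSheafData.ideal_pow, Pi.pow_apply, Scheme.IdealSheafData.ofIdealTop_ideal,
    Ideal.map_span, Set.image_singleton, Ideal.span_singleton_pow, map_pow]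

/-- If `aᵈ` acts as zero on `N`, then `N` is killed by the ideal sheaf `(a)ᵈ`
(`Scheme.IdealSheafData.ofIdealTop`). [cite: StacksProject, Tag 088A] -/
theorem isKilledBy_pow_ofIdealTop_of_globalScalar_eq_zero {N : X.Modules} {d : ℕ}
    (hN : globalScalar N (a ^ d) = 0) :
    IsKilledBy (Scheme.IdealSheafData.ofIdealTop (Ideal.span {a}) ^ d) N := by
  intro V r hr n
  rw [ideal_pow_ofIdealTop_span, Ideal.mem_span_singleton'] at hr
  obtain ⟨c, rfl⟩ := hr
  have h : X.presheaf.map (homOfLE (le_top : (V : X.Opens) ≤ ⊤)).op (a ^ d) • n = 0 := by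
    simpa [Scheme.Modules.Hom.zero_app] using congrArg (fun φ => φ.app (V : X.Opens) n) hN
  rw [mul_smul, h, smul_zero]

/-- Conversely, a module killed by the ideal sheaf `(a)ᵉ` is killed by `aᵉ`: a morphism of sheaves
of modules vanishes as soon as it vanishes on the sections over the affine opens.
[cite: StacksProject, Tag 088A] -/
theorem globalScalar_eq_zero_of_isKilledBy_pow_ofIdealTop {N : X.Modules} {e : ℕ}
    (hN : IsKilledBy (Scheme.IdealSheafData.ofIdealTop (Ideal.span {a}) ^ e) N) :
    globalScalar N (a ^ e) = 0 := by
  refine Scheme.Modules.hom_ext _ _ fun U => ?_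
  ext n
  rw [Scheme.Modules.Hom.zero_app]
  change (globalScalar N (a ^ e)).app U n = 0
  refine eq_zero_of_map_eq_zero_on_basis X.isBasis_affineOpens _ fun V hV hVU => ?_
  rw [← app_presheaf_map, globalScalar_app_apply]
  -- over the affine `V`, `aᵉ|_V` lies in `(a)ᵉ(V)`
  refine hN ⟨V, hV⟩ _ ?_ (N.presheaf.map (homOfLE hVU).op n)
  rw [ideal_pow_ofIdealTop_span]
  exact Ideal.mem_span_singleton_self _

/-- Every module is killed by the zero ideal sheaf. [cite: StacksProject, Tag 088A] -/
theorem isKilledBy_bot (N : X.Modules) : IsKilledBy (⊥ : X.IdealSheafData) N := by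
  intro V r hr n
  rw [Scheme.IdealSheafData.ideal_bot, Pi.bot_apply, Ideal.mem_bot] at hr
  rw [hr, zero_smul]

end Killed

/-! ### Formal towers killed by a fixed power of `a` are completion towers -/

section EventuallyConstant

variable {X : Scheme.{u}} {a : Γ(X, ⊤)} {F : ℕᵒᵖ ⥤ X.Modules} (hF : IsFormalTower a F)
include hF

/-- In a formal tower along `a` whose levels are all killed by `aᵉ`, the transition map
`F_{m+1} → F_m` is an isomorphism as soon as `e ≤ m + 1` (an epimorphism with kernel
`aᵐ⁺¹F_{m+1} = 0`). [cite: GortzWedhorn2023, (24.18.1) (p. 562)] -/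
theorem IsFormalTower.isIso_towerπ_of_pow_killed {e : ℕ}
    (hk : ∀ n, globalScalar (F.obj ⟨n⟩) (a ^ e) = 0) {m : ℕ} (h : e ≤ m + 1) :
    IsIso (towerπ F m) := by
  haveI : Epi (towerπ F m) := hF.epi m
  have hzero : globalScalar (F.obj ⟨m + 1⟩) (a ^ (m + 1)) = 0 := by
    rw [show a ^ (m + 1) = a ^ (m + 1 - e) * a ^ e by rw [← pow_add]; congr 1; omega,
      globalScalar_mul, hk (m + 1), zero_comp]
  haveI : Mono (towerπ F m) := (hF.exact m).mono_g hzero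
  exact isIso_of_mono_of_epi _

/-- In a formal tower along `a` whose levels are all killed by `aᵉ`, the transition maps
`F_m → F_e` (`e ≤ m`) are isomorphisms. [cite: GortzWedhorn2023, (24.18.1) (p. 562)] -/
theorem IsFormalTower.isIso_map_of_pow_killed {e : ℕ}
    (hk : ∀ n, globalScalar (F.obj ⟨n⟩) (a ^ e) = 0) {m : ℕ} (h : e ≤ m) :
    IsIso (F.map (homOfLE h).op) := by
  induction m, h using Nat.le_induction with
  | base =>
    rw [show (homOfLE (le_refl e)).op = 𝟙 (op e) from Subsingleton.elim _ _, F.map_id]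
    infer_instance
  | succ m hem ih =>
    have hsplit : (homOfLE (Nat.le_succ_of_le hem)).op =
        (homOfLE (Nat.le_succ m)).op ≫ (homOfLE hem).op := Subsingleton.elim _ _
    rw [hsplit, F.map_comp]
    haveI := ih
    haveI : IsIso (towerπ F m) := hF.isIso_towerπ_of_pow_killed hk (by omega)
    change IsIso (towerπ F m ≫ F.map (homOfLE hem).op)
    infer_instance

/-- **A formal tower of coherent modules along `a` killed by a fixed power `aᵉ` is the completion
tower of its `e`-th level** (it is eventually constant). This is the inductive input of the
tricky lemma (Stacks 088A) in the case `𝒥 = (a)`. [cite: StacksProject, Tag 088A]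
[cite: GortzWedhorn2023, (24.18.1) (p. 562)] -/
theorem IsFormalTower.exists_coh_iso_cmplTower_of_pow_killed (hFc : ∀ n, Coh (F.obj ⟨n⟩)) {e : ℕ}
    (hk : ∀ n, globalScalar (F.obj ⟨n⟩) (a ^ e) = 0) :
    ∃ G : X.Modules, Coh G ∧ Nonempty (F ≅ cmplTower a G) := by
  -- reference level `G = F_e`; `ψ n : G → F_n` goes up to level `e + n` and down to level `n`
  have hiso : ∀ n, IsIso (F.map (homOfLE (Nat.le_add_right e n)).op) := fun n =>
    hF.isIso_map_of_pow_killed hk _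
  have hπiso : ∀ n, IsIso (towerπ F (e + n)) := fun n =>
    hF.isIso_towerπ_of_pow_killed hk (by omega)
  let ψ : ∀ n : ℕ, F.obj ⟨e⟩ ⟶ F.obj ⟨n⟩ := fun n =>
    inv (F.map (homOfLE (Nat.le_add_right e n)).op) ≫ F.map (homOfLE (Nat.le_add_left n e)).op
  have hψ_def : ∀ n, ψ n = inv (F.map (homOfLE (Nat.le_add_right e n)).op) ≫
      F.map (homOfLE (Nat.le_add_left n e)).op := fun n => rfl
  have hψ_succ : ∀ n, ψ (n + 1) ≫ towerπ F n = ψ n := by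
    intro n
    have hA : F.map (homOfLE (Nat.le_add_right e (n + 1))).op =
        towerπ F (e + n) ≫ F.map (homOfLE (Nat.le_add_right e n)).op := by
      rw [towerπ, ← F.map_comp]
      exact congrArg F.map (Subsingleton.elim _ _)
    have hB : F.map (homOfLE (Nat.le_add_left (n + 1) e)).op ≫ towerπ F n =
        towerπ F (e + n) ≫ F.map (homOfLE (Nat.le_add_left n e)).op := by
      rw [towerπ, towerπ, ← F.map_comp, ← F.map_comp]
      exact congrArg F.map (Subsingleton.elim _ _)
    haveI := hiso n
    haveI := hπiso n
    rw [hψ_def, hψ_def, Category.assoc, hB, IsIso.inv_comp_eq, hA, Category.assoc,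
      IsIso.hom_inv_id_assoc]
  have hψ_kill : ∀ n, globalScalar (F.obj ⟨e⟩) (a ^ (n + 1)) ≫ ψ n = 0 := fun n => by
    rw [globalScalar_comp, hF.killed n, comp_zero]
  -- the levelwise comparison `G/aⁿ⁺¹G → F_n`
  let p : ∀ n : ℕ, cmplObj a (F.obj ⟨e⟩) n ⟶ F.obj ⟨n⟩ := fun n =>
    cokernel.desc _ (ψ n) (hψ_kill n)
  have hp : ∀ n, cmplπ a (F.obj ⟨e⟩) n ≫ p n = ψ n := fun n => cokernel.π_desc _ _ _
  -- naturality
  let P : cmplTower a (F.obj ⟨e⟩) ⟶ F := NatTrans.ofOpSequence p fun n => by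
    change towerπ (cmplTower a (F.obj ⟨e⟩)) n ≫ p n = p (n + 1) ≫ towerπ F n
    rw [towerπ_cmplTower, ← cancel_epi (cmplπ a (F.obj ⟨e⟩) (n + 1)), cmplπ_cmplStep_assoc, hp,
      ← Category.assoc, hp, hψ_succ]
  -- each `p n` is an isomorphism, with inverse induced by `F_{e+n} → F_e → G/aⁿ⁺¹G`
  have hPiso : ∀ n, IsIso (p n) := by
    intro n
    haveI := hiso n
    have hkill : globalScalar (F.obj ⟨e + n⟩) (a ^ (n + 1)) ≫
        (F.map (homOfLE (Nat.le_add_right e n)).op ≫ cmplπ a (F.obj ⟨e⟩) n) = 0 := by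
      have hc : globalScalar (F.obj ⟨e⟩) (a ^ (n + 1)) ≫ cmplπ a (F.obj ⟨e⟩) n = 0 :=
        cokernel.condition _
      rw [globalScalar_comp_assoc, hc, comp_zero]
    obtain ⟨q, hq, -⟩ := hF.existsUnique_desc (Nat.le_add_left n e) _ hkill
    refine ⟨q, ?_, ?_⟩
    · rw [← cancel_epi (cmplπ a (F.obj ⟨e⟩) n), ← Category.assoc, hp, Category.comp_id, hψ_def,
        Category.assoc, hq, IsIso.inv_hom_id_assoc]
    · haveI : Epi (F.map (homOfLE (Nat.le_add_left n e)).op) := hF.epi_map _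
      rw [← cancel_epi (F.map (homOfLE (Nat.le_add_left n e)).op), ← Category.assoc, hq,
        Category.assoc, hp, Category.comp_id, hψ_def, IsIso.hom_inv_id_assoc]
  haveI : ∀ k : ℕᵒᵖ, IsIso (P.app k) := fun k => hPiso k.unop
  haveI : IsIso P := NatIso.isIso_of_isIso_app P
  exact ⟨F.obj ⟨e⟩, hFc e, ⟨(asIso P).symm⟩⟩

end EventuallyConstant

/-! ### The tricky lemma along `𝒥 = (a)` -/

section Comparison

variable {A : Type u} [CommRing A] [IsNoetherianRing A] {X : Scheme.{u}} (f : X ⟶ Spec (.of A))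
  [IsProper f] (a : A) [IsAdicComplete (Ideal.span {a}) A] [IsLocallyNoetherian X] [CompactSpace X]

/-- **Algebraization from an `a`-power isogeny to a completion tower** (the tricky lemma,
Stacks 088A, along `𝒥 = (a)`). Let `X → Spec A` be proper with `A` noetherian and `a`-adically
complete, `𝓕` a formal tower of coherent `𝒪_X`-modules along `a`, `H` a coherent `𝒪_X`-module and
`α : 𝓕 → H^ = (H/aⁿ⁺¹H)_n` a morphism of towers such that, for one `d` and every `n`, `aᵈ` kills the
kernel and the cokernel of `α_n`. Then `𝓕` is the completion tower of a coherent `𝒪_X`-module.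
(The coherent formal modules killed by `(a)ᵉ` required by the tricky lemma are eventually constant
towers, `IsFormalTower.exists_coh_iso_cmplTower_of_pow_killed`.) [cite: StacksProject, Tag 088A]
[cite: GortzWedhorn2023, Lemma 24.105 and Lemma 24.106 (pp. 572–573)] -/
theorem exists_coh_iso_cmplTower_of_powTorsion_comparison {𝓕 : ℕᵒᵖ ⥤ X.Modules}
    (h𝓕 : IsFormalTower (algebraMapΓ f a) 𝓕) (h𝓕c : ∀ n, Coh (𝓕.obj ⟨n⟩)) {H : X.Modules}
    (hH : Coh H) (α : 𝓕 ⟶ cmplTower (algebraMapΓ f a) H) {d : ℕ}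
    (hker : ∀ n, kernel.ι (α.app ⟨n⟩) ≫ globalScalar (𝓕.obj ⟨n⟩) (algebraMapΓ f a ^ d) = 0)
    (hcoker : ∀ n, globalScalar ((cmplTower (algebraMapΓ f a) H).obj ⟨n⟩) (algebraMapΓ f a ^ d) ≫
      cokernel.π (α.app ⟨n⟩) = 0) :
    ∃ F : X.Modules, Coh F ∧ Nonempty (𝓕 ≅ cmplTower (algebraMapΓ f a) F) := by
  refine exists_coh_iso_of_torsion_kernel_cokernel f a h𝓕 h𝓕c hH α
    (K := ⊥) (J := Scheme.IdealSheafData.ofIdealTop (Ideal.span {algebraMapΓ f a})) (d := d)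
    (fun n => isKilledBy_bot _) (isKilledBy_bot _) (fun n => ?_) (fun n => ?_)
    (fun e _ 𝓖 h𝓖 h𝓖c _ h𝓖J => ?_)
  · -- the kernel of `α_n` is killed by `aᵈ`
    refine isKilledBy_pow_ofIdealTop_of_globalScalar_eq_zero (algebraMapΓ f a) ?_
    rw [← cancel_mono (kernel.ι (α.app ⟨n⟩)), globalScalar_comp, zero_comp]
    exact hker n
  · -- the cokernel of `α_n` is killed by `aᵈ`
    refine isKilledBy_pow_ofIdealTop_of_globalScalar_eq_zero (algebraMapΓ f a) ?_
    rw [← cancel_epi (cokernel.π (α.app ⟨n⟩)), ← globalScalar_comp, comp_zero]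
    exact hcoker n
  · -- towers killed by `(a)ᵉ` are eventually constant
    exact h𝓖.exists_coh_iso_cmplTower_of_pow_killed h𝓖c (e := e) fun n =>
      globalScalar_eq_zero_of_isKilledBy_pow_ofIdealTop (algebraMapΓ f a) (h𝓖J n)

end Comparison

end Literature.AlgebraicGeometry.Morphisms

end
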